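import Mathlib
import Literature.NumberTheory.LFunctions.Zhang2022.Section8Step8u014
import HarnessLib

/-!
# Zhang (2022) §7–§8: products and reflections of the Dirichlet polynomials `A(a;s,ψ)` — the algebra
# behind "Cauchy's inequality … and the second assertion of Lemma 3.3" for PRODUCTS of polynomials of
# different lengths

Y. Zhang, *Discrete mean estimates and the Landau–Siegel zero*, arXiv:2211.02515v1 (2022)
[Zhang2022LandauSiegel] — **an unrefereed manuscript under adjudication; nothing here asserts or denies its
Theorems 1–2; no claim about Landau–Siegel zeros.** Cell landau-siegel §D; helper algebra for the long-leg
Lemma 8.1 slots (`LongLegSplit.Lemma81LongPsiDil`, line `Cruxes/PsiGradedTablesClosePoly/Lines/long_poly_dil.lean`,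
stub `stub_lemma81LongPsiDil`, crux stmt-Parity-22438), step `Z22:§8.u014` re-run for data of UNEQUAL lengths.

The printed step (§8 p. 43: "By Cauchy's inequality, Lemma 6.1, and the second assertion of Lemma 3.3 …
`Σ_ψ |A(𝐚₁;s,ψ)A(𝐚₂,1−s,ψ̄)|² ≪ P²𝓛³⁶`") squares ONE polynomial (`Ded81Edge.dirPoly_sq_eq`). When the two data have
different lengths one needs instead:

* `dirPoly_mul_dirPoly_eq` — **`A_{N₁}(a;w,θ)·A_{N₂}(b;w,θ) = Σ_{1≤m≤M} (a⋆b)(m)θ(m)m^{−w}`** for every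
  `M ≥ (N₁−1)(N₂−1)`, with the truncated convolution `(a⋆b)(m) = Σ_{n₁n₂=m, 1≤n_i<N_i} a(n₁)b(n₂)` written out as a filtered sum;
* `norm_prodCoeff_le` — **`|(a⋆b)(m)| ≤ Σ_{d∣m} α(d)β(m/d)`** under termwise majorants `|a| ≤ α`, `|b| ≤ β`
  (the divisor-class form of `Ded81Edge.norm_sqCoeff_le`);
* `dirPoly_one_sub_conj` — **`A_N(a;1−s̄,θ) = A_N(a·n^{2σ−1};s,θ)`** (`σ = Re s`): on a vertical line the
  reflected point `1−s̄` differs from `s` by the REAL shift `2σ−1`, so the reflected polynomial is again a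
  Dirichlet polynomial AT `s` with `s`-free twisted coefficients;
* `norm_dirPoly_inv_one_sub_eq` — **`|A_N(a;1−s,θ̄)| = |A_N(ā·n^{2σ−1};s,θ)|`**, the form in which the k-side
  factor `A(𝐚₂;1−s,ψ̄)` joins a ψ-side product before the large sieve (Lemma 3.3 (ii), `Skeleton.Lemma33b`).

Pure finite-sum algebra; no Assumption (A); theorems only, no `def`.

## References
* Y. Zhang, arXiv:2211.02515v1 (2022), §7 p. 13 (after (7.2)); §8 p. 16 and p. 43 (proof of Lemma 8.1).
  [cite: Zhang2022LandauSiegel, §7 p.13; §8 p.43]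
-/

noncomputable section

open Complex Real ComplexConjugate Finset

namespace Literature.NumberTheory.LFunctions.Zhang2022.Ded81Edge

/-! ### The truncated convolution and the product of two Dirichlet polynomials -/

/-- **`A_{N₁}(a;w,θ)·A_{N₂}(b;w,θ) = Σ_{1≤m≤M} (a⋆b)(m)θ(m)m^{−w}`** for every `M ≥ (N₁−1)(N₂−1)`: the product
of two Dirichlet polynomials of lengths `N₁, N₂` is one Dirichlet polynomial of length `(N₁−1)(N₂−1)`
(the two-length form of `dirPoly_sq_eq`). [cite: Zhang2022LandauSiegel, §8 p.43] -/
theorem dirPoly_mul_dirPoly_eq {k : ℕ} [NeZero k] (N₁ N₂ : ℕ) (a b : ℕ → ℂ) (θ : DirichletCharacter ℂ k)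
    (hk : k ≠ 1) (w : ℂ) {M : ℕ} (hM : (N₁ - 1) * (N₂ - 1) ≤ M) :
    Lemma81.dirPoly N₁ a θ w * Lemma81.dirPoly N₂ b θ w =
      ∑ m ∈ Icc 1 M,
        (∑ p ∈ (Ico 1 N₁ ×ˢ Ico 1 N₂).filter (fun p => p.1 * p.2 = m), a p.1 * b p.2) *
          θ m * (m : ℂ) ^ (-w) := by
  have hmaps : ∀ p ∈ Ico 1 N₁ ×ˢ Ico 1 N₂, p.1 * p.2 ∈ Icc 1 M := by
    intro p hp
    rw [Finset.mem_product, Finset.mem_Ico, Finset.mem_Ico] at hp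
    rw [Finset.mem_Icc]
    refine ⟨Nat.one_le_iff_ne_zero.mpr (Nat.mul_ne_zero (by omega) (by omega)), ?_⟩
    calc p.1 * p.2 ≤ (N₁ - 1) * (N₂ - 1) := Nat.mul_le_mul (by omega) (by omega)
      _ ≤ M := hM
  rw [dirPoly_eq_sum_Ico N₁ a θ hk, dirPoly_eq_sum_Ico N₂ b θ hk, Finset.sum_mul_sum,
    ← Finset.sum_product']
  rw [← Finset.sum_fiberwise_of_maps_to hmaps]
  refine Finset.sum_congr rfl fun m _ => ?_
  rw [Finset.sum_mul, Finset.sum_mul]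
  refine Finset.sum_congr rfl fun p hp => ?_
  obtain ⟨-, hpm⟩ := Finset.mem_filter.mp hp
  rw [← hpm]
  simp only [Nat.cast_mul, map_mul, Complex.natCast_mul_natCast_cpow]
  ring

/-- `#{(n₁,n₂) : n₁n₂ = m}` restricted to a box is at most `τ(m)`, refined: the fibre of `m` in
`Ico 1 N₁ ×ˢ Ico 1 N₂` injects into `m.divisorsAntidiagonal`. [folklore] -/
private theorem filter_mul_eq_subset_divisorsAntidiagonal (N₁ N₂ : ℕ) {m : ℕ} (hm : m ≠ 0) :
    (Ico 1 N₁ ×ˢ Ico 1 N₂).filter (fun p => p.1 * p.2 = m) ⊆ m.divisorsAntidiagonal := by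
  intro p hp
  obtain ⟨-, hpm⟩ := Finset.mem_filter.mp hp
  exact Nat.mem_divisorsAntidiagonal.mpr ⟨hpm, hm⟩

/-- **`|(a⋆b)(m)| ≤ Σ_{(d,e): de = m} α(d)β(e)`** for termwise majorants `‖a n‖ ≤ α n`, `‖b n‖ ≤ β n` with
`α, β ≥ 0` (the divisor-class form of `norm_sqCoeff_le`; with `α = β = B` constant it gives `B²τ(m)`).
[cite: Zhang2022LandauSiegel, §8 p.43] -/
theorem norm_prodCoeff_le (N₁ N₂ : ℕ) {a b : ℕ → ℂ} {α β : ℕ → ℝ} (ha : ∀ n, ‖a n‖ ≤ α n)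
    (hb : ∀ n, ‖b n‖ ≤ β n) (hα : ∀ n, 0 ≤ α n) (hβ : ∀ n, 0 ≤ β n) {m : ℕ} (hm : m ≠ 0) :
    ‖∑ p ∈ (Ico 1 N₁ ×ˢ Ico 1 N₂).filter (fun p => p.1 * p.2 = m), a p.1 * b p.2‖ ≤
      ∑ p ∈ m.divisorsAntidiagonal, α p.1 * β p.2 := by
  calc ‖∑ p ∈ (Ico 1 N₁ ×ˢ Ico 1 N₂).filter (fun p => p.1 * p.2 = m), a p.1 * b p.2‖
      ≤ ∑ p ∈ (Ico 1 N₁ ×ˢ Ico 1 N₂).filter (fun p => p.1 * p.2 = m), ‖a p.1 * b p.2‖ :=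
        norm_sum_le _ _
    _ ≤ ∑ p ∈ (Ico 1 N₁ ×ˢ Ico 1 N₂).filter (fun p => p.1 * p.2 = m), α p.1 * β p.2 := by
        refine Finset.sum_le_sum fun p _ => ?_
        rw [norm_mul]
        exact mul_le_mul (ha _) (hb _) (norm_nonneg _) (hα _)
    _ ≤ ∑ p ∈ m.divisorsAntidiagonal, α p.1 * β p.2 :=
        Finset.sum_le_sum_of_subset_of_nonneg (filter_mul_eq_subset_divisorsAntidiagonal N₁ N₂ hm)
          fun p _ _ => mul_nonneg (hα _) (hβ _)

/-- The constant-majorant case: `‖a‖, ‖b‖ ≤ B` gives `|(a⋆b)(m)| ≤ B²τ(m)`.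
[cite: Zhang2022LandauSiegel, §8 p.43] -/
theorem norm_prodCoeff_le_const (N₁ N₂ : ℕ) {a b : ℕ → ℂ} {B : ℝ} (ha : ∀ n, ‖a n‖ ≤ B)
    (hb : ∀ n, ‖b n‖ ≤ B) {m : ℕ} (hm : m ≠ 0) :
    ‖∑ p ∈ (Ico 1 N₁ ×ˢ Ico 1 N₂).filter (fun p => p.1 * p.2 = m), a p.1 * b p.2‖ ≤
      B ^ 2 * m.divisors.card := by
  have hB : 0 ≤ B := (norm_nonneg _).trans (ha 0)
  have h := norm_prodCoeff_le N₁ N₂ (α := fun _ => B) (β := fun _ => B) ha hb (fun _ => hB) (fun _ => hB) hm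
  refine h.trans (le_of_eq ?_)
  rw [Finset.sum_const, nsmul_eq_mul, ← Nat.map_div_right_divisors, Finset.card_map]
  ring

/-! ### The reflected point `1 − s̄` and the k-side factor `A(𝐚₂;1−s,ψ̄)` -/

/-- `n^{−(1−s̄)} = n^{2σ−1}·n^{−s}` for `n ≥ 1` (`σ = Re s`): the reflected exponent differs from `s` by the
REAL number `2σ − 1`. [folklore] -/
private theorem natCast_cpow_neg_one_sub_conj {n : ℕ} (hn : n ≠ 0) (s : ℂ) :
    (n : ℂ) ^ (-(1 - conj s)) = (n : ℂ) ^ (((2 * s.re - 1 : ℝ)) : ℂ) * (n : ℂ) ^ (-s) := by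
  have hn' : (n : ℂ) ≠ 0 := Nat.cast_ne_zero.mpr hn
  rw [← Complex.cpow_add _ _ hn']
  congr 1
  apply Complex.ext
  · simp [Complex.sub_re, Complex.neg_re, Complex.one_re, Complex.conj_re, Complex.add_re,
      Complex.ofReal_re]
    ring
  · simp [Complex.sub_im, Complex.neg_im, Complex.one_im, Complex.conj_im, Complex.add_im,
      Complex.ofReal_im]

/-- **`A_N(a;1−s̄,θ) = A_N(a·n^{2σ−1};s,θ)`**: the Dirichlet polynomial at the reflected point `1 − s̄` is a
Dirichlet polynomial AT `s` whose coefficients `a(n)n^{2σ−1}` do not depend on `Im s` (modulus `k ≠ 1`, so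
the `n = 0` term is absent). [cite: Zhang2022LandauSiegel, §8 p.16, p.43] -/
theorem dirPoly_one_sub_conj {k : ℕ} [NeZero k] (hk : k ≠ 1) (N : ℕ) (a : ℕ → ℂ)
    (θ : DirichletCharacter ℂ k) (s : ℂ) :
    Lemma81.dirPoly N a θ (1 - conj s) =
      Lemma81.dirPoly N (fun n => a n * (n : ℂ) ^ (((2 * s.re - 1 : ℝ)) : ℂ)) θ s := by
  rw [dirPoly_eq_sum_Ico N a θ hk, dirPoly_eq_sum_Ico N _ θ hk]
  refine Finset.sum_congr rfl fun n hn => ?_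
  have hn1 : n ≠ 0 := by have := (Finset.mem_Ico.mp hn).1; omega
  rw [natCast_cpow_neg_one_sub_conj hn1 s]
  ring

/-- **`|A_N(a;1−s,θ̄)| = |A_N(ā·n^{2σ−1};s,θ)|`** (`θ̄ = θ⁻¹`, `σ = Re s`): the k-side factor of Lemma 8.1's
integrand has the modulus of a `θ`-polynomial at the SAME point `s` — so a product with ψ-side factors at `s`
is one Dirichlet polynomial at `s`, ready for Lemma 3.3 (ii). [cite: Zhang2022LandauSiegel, §8 p.43] -/
theorem norm_dirPoly_inv_one_sub_eq {k : ℕ} [NeZero k] (hk : k ≠ 1) (N : ℕ) (a : ℕ → ℂ)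
    (θ : DirichletCharacter ℂ k) (s : ℂ) :
    ‖Lemma81.dirPoly N a θ⁻¹ (1 - s)‖ =
      ‖Lemma81.dirPoly N (fun n => conj (a n) * (n : ℂ) ^ (((2 * s.re - 1 : ℝ)) : ℂ)) θ s‖ := by
  rw [norm_dirPoly_inv_eq N a θ (1 - s), map_sub, map_one, dirPoly_one_sub_conj hk]

/-- On the line `Re s = ½ + α` the twist exponent is `2σ − 1 = 2α` and the twisted coefficients are bounded
by `‖a n‖·n^{2α}` (`n ≥ 1`). [cite: Zhang2022LandauSiegel, §8 p.43] -/
theorem norm_mul_cpow_twist_le {n : ℕ} (hn : n ≠ 0) (a : ℂ) (x : ℝ) :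
    ‖a * (n : ℂ) ^ ((x : ℝ) : ℂ)‖ ≤ ‖a‖ * (n : ℝ) ^ x := by
  rw [norm_mul, Complex.norm_natCast_cpow_of_pos (Nat.pos_of_ne_zero hn), Complex.ofReal_re]

end Literature.NumberTheory.LFunctions.Zhang2022.Ded81Edge

end
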